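import Summits.ResolutionOfSingularities.ResolutionOfSingularities.Theorems.PurelyInseparableDim4RidgeBudget
import Literature.AlgebraicGeometry.Resolution.HironakaDirectrixPrincipal
import Literature.AlgebraicGeometry.Resolution.PointBlowupDirectrixBaseChange
import Mathlib.FieldTheory.Perfect
import HarnessLib
import HarnessLib.Audit.Tags

/-!
# Purely inseparable dim 4 — the DIRECTRIX of the cone `z^p + Φ(x)` is the ridge `A(Φ)`: `e((z^p + Φ)) = ē(F)`

The (E)-identity of the E2(3,3) dictionary (cell `res-dim4-pi`, desk WORD #52 (c); consumer: sub-row (E)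
«`dirDim X x = ebar F`» of `IsolatedConeTwoChainLocalizes`, seats p-2 g2 / p-1 g2), at the POLYNOMIAL level and
def-free over the tree's vocabulary:

* Hironaka's translation-invariance space `𝕎({G}) = invarianceSpace k {G}` (`HironakaDirectrix.lean`) and
  `e((G)) = directrixDim (Ideal.span {G}) = 5 − τ({G}) = dim_k 𝕎({G})` for a non-zero form `G`
  (`directrixDim_span_singleton`, `hironakaTau_add_finrank_invarianceSpace` — CJS Def. 2.8 for a principal
  ideal);
* the frame's ridge `A(Φ) = PointBlowup.additiveSubspace Φ = ker (polar map)` and `RidgeBudget.ebar F =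
  dim_k A(in F)`;
* `G = PIDim4.hyp p Φ = X 0 ^ p + rename Fin.succ Φ`, the tangent form of `z^p + F` when `Φ = in F`, `ord₀ F = p`.

PROVED: §1 `additiveSubspace_eq_hasseNull` — in characteristic `p`, `A(Φ)` is Hironaka's Hasse null space
`S_p(Φ)` (all directional Hasse derivatives of orders `1, …, p−1` vanish as soon as the first polar does:
`D_v^{(j)}(∂_vΦ) = (j+1) D_v^{(j+1)}Φ`, `j + 1 < p` a unit); §2 bookkeeping for `hyp p Φ` (`D_w^{(j)}(x_0^p) = 0`
for `0 < j < p`; `D_w^{(j)}` commutes with `rename Fin.succ`); §3 **`mem_invarianceSpace_hyp_iff`** —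
`w ∈ 𝕎({z^p + Φ}) ⟺ (w_1, …, w_4) ∈ A(Φ) ∧ w_0^p + Φ(w_1, …, w_4) = 0` (the `k`-points of the ridge of the cone);
§4 **`finrank_invarianceSpace_hyp`** — over a PERFECT field the projection `(w_0, w') ↦ w'` is a `k`-linear
bijection `𝕎({z^p + Φ}) ≅ A(Φ)` (injective: `w' = 0 ⇒ w_0^p = 0`; surjective: `w_0 = (−Φ(w'))^{1/p}`), so
`dim 𝕎 = dim A(Φ)`; without perfectness `dim 𝕎 ≤ dim A(Φ)`; §5 **`directrixDim_span_hyp`** —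
`e((z^p + Φ)) = dim_k A(Φ)`, and `directrixDim_span_hyp_initialForm`: `= RidgeBudget.ebar F` at `ord₀ F = p`.
§6 base change: `directrixDim_span_map_hyp` — over any perfect extension `K/k` (e.g. `k̄`, giving `ē`),
`e((z^p + Φ) ⊗ K) = dim_k A(Φ)` (§5 over `K` + the tree's `PointBlowup.finrank_additiveSubspace_map`), and the
`f : k →+* K` form `directrixDim_span_map_hyp'` for transports along residue-field isomorphisms.

[cite: CossartJannsenSaito2020, Def. 2.8, Def. 2.18 and Def. 2.21 (directrix of the tangent cone; e, ē)]
[cite: BerthomieuHivertMourtada2010, Cor. 2.3 (the ridge via Hasse–Schmidt derivatives)]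
OURS · counted 0 · nothing here proves E2(3,3), `NoIsolatedTrap 3 3`, or resolution of singularities in dimension
`≥ 4` / characteristic `p`.  Supports stmt-ResolutionOfSingularities-16155 (helper).
bears_on: LADDER-RESOLUTION:D157-DOOR2 (res-dim4-pi · E2 dictionary · sub-row (E) identity).
-/

set_option linter.dupNamespace false -- mandated namespace of this single-conjunct summit

noncomputable section

namespace Summit.ResolutionOfSingularities.ResolutionOfSingularities.Theorems.PIDim4

namespace RidgeDirectrix

open MvPolynomial Finset
open Literature.AlgebraicGeometry.Resolution
open Literature.AlgebraicGeometry.Resolution.Hauser2010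
open Literature.AlgebraicGeometry.Resolution.HauserPerlega2019
open Literature.AlgebraicGeometry.Resolution.WeightedBlowup.HasseDir
open Literature.RingTheory.MvPolynomial (directrixDim)
open PointBlowup (additiveSubspace polarMap)

variable {k : Type} [Field k]

/-! ## 1. In characteristic `p` the ridge `A(Φ)` is the Hasse null space `S_p(Φ)` -/

/-- The first directional Hasse derivative is the polar: `D_v^{(1)} Φ = Σ_i v_i ∂_iΦ`. [folklore] -/
theorem hasseD_one_eq_polarMap {σ : Type*} [Fintype σ] [DecidableEq σ] (v : σ → k) (Φ : MvPolynomial σ k) :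
    hasseD v 1 Φ = polarMap Φ v := by
  have h := hasseD_polar_eq v 0 Φ
  simp only [hasseD_zero, Nat.cast_zero, zero_add, mul_one] at h
  rw [← h, PointBlowup.polarMap, Fintype.linearCombination_apply]
  refine Finset.sum_congr rfl fun i _ => ?_
  rw [smul_eq_C_mul]

/-- **A vanishing polar kills the Hasse layers `1, …, p − 1`** in characteristic `p`
(`D_v^{(j)}(∂_vΦ) = (j+1)·D_v^{(j+1)}Φ` and `j + 1` is a unit below `p`).
[cite: BerthomieuHivertMourtada2010, Cor. 2.3] -/
theorem hasseD_eq_zero_of_polarMap_eq_zero (p : ℕ) [Fact p.Prime] [CharP k p] {σ : Type*} [Fintype σ]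
    [DecidableEq σ] {v : σ → k} {Φ : MvPolynomial σ k} (hv : polarMap Φ v = 0) :
    ∀ j, 1 ≤ j → j < p → hasseD v j Φ = 0 := by
  intro j hj1 hjp
  obtain ⟨m, rfl⟩ : ∃ m, j = m + 1 := ⟨j - 1, by omega⟩
  have h := hasseD_polar_eq v m Φ
  have hpol : ∑ i, C (v i) * pderiv i Φ = polarMap Φ v := by
    rw [PointBlowup.polarMap, Fintype.linearCombination_apply]
    exact Finset.sum_congr rfl fun i _ => (smul_eq_C_mul _ _).symm
  rw [hpol, hv, hasseD_zero_right] at h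
  have hne : ((m : MvPolynomial σ k) + 1) ≠ 0 := by
    rw [← Nat.cast_succ, ← map_natCast (C : k →+* MvPolynomial σ k), Ne, C_eq_zero,
      CharP.cast_eq_zero_iff k p]
    exact fun hdvd => absurd (Nat.le_of_dvd (by omega) hdvd) (by omega)
  exact (mul_eq_zero.mp h.symm).resolve_right hne

/-- **`A(Φ) = S_p(Φ)`**: in characteristic `p` the frame's additive subspace (kernel of the polar map) is
Hironaka's Hasse null space of order `p`. [cite: BerthomieuHivertMourtada2010, Cor. 2.3] -/
theorem additiveSubspace_eq_hasseNull (p : ℕ) [Fact p.Prime] [CharP k p] {σ : Type*} [Fintype σ]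
    [DecidableEq σ] (Φ : MvPolynomial σ k) : additiveSubspace Φ = hasseNull p Φ := by
  have hp : 1 < p := (Fact.out : p.Prime).one_lt
  ext v
  rw [PointBlowup.additiveSubspace, LinearMap.mem_ker, mem_hasseNull]
  constructor
  · exact hasseD_eq_zero_of_polarMap_eq_zero p
  · intro h
    rw [← hasseD_one_eq_polarMap]
    exact h 1 le_rfl hp

/-! ## 2. The tangent form `hyp p Φ = x_0^p + Φ(x_1, …, x_4)` -/

/-- `D_w^{(j)}(x_0^p) = 0` for `0 < j < p` in characteristic `p`. [folklore] -/
theorem hasseD_X_zero_pow_eq_zero (p : ℕ) [Fact p.Prime] [CharP k p] (w : Fin (4 + 1) → k) {j : ℕ}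
    (hj1 : 1 ≤ j) (hjp : j < p) :
    hasseD w j ((X 0 : MvPolynomial (Fin (4 + 1)) k) ^ p) = 0 := by
  rw [hasseD_X_pow]
  have hc : ((p.choose j : ℕ) : k) = 0 :=
    (CharP.cast_eq_zero_iff k p _).mpr ((Fact.out : p.Prime).dvd_choose_self (by omega) hjp)
  rw [hc, zero_mul, C_0, zero_mul]

/-- The directional shift commutes with the embedding `rename Fin.succ`. [folklore] -/
theorem dirShift_rename_succ (w : Fin (4 + 1) → k) (Φ : MvPolynomial (Fin 4) k) :
    dirShift w (rename Fin.succ Φ) =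
      Polynomial.map (rename Fin.succ : MvPolynomial (Fin 4) k →ₐ[k] MvPolynomial (Fin (4 + 1)) k).toRingHom
        (dirShift (w ∘ Fin.succ) Φ) := by
  have key : (dirShift w).toRingHom.comp
      (rename Fin.succ : MvPolynomial (Fin 4) k →ₐ[k] MvPolynomial (Fin (4 + 1)) k).toRingHom =
      (Polynomial.mapRingHom
        (rename Fin.succ : MvPolynomial (Fin 4) k →ₐ[k] MvPolynomial (Fin (4 + 1)) k).toRingHom).comp
        (dirShift (w ∘ Fin.succ)).toRingHom := by
    refine MvPolynomial.ringHom_ext (fun a => ?_) (fun i => ?_)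
    · simp only [RingHom.comp_apply, AlgHom.toRingHom_eq_coe, RingHom.coe_coe, rename_C, dirShift_C,
        Polynomial.coe_mapRingHom, Polynomial.map_C]
    · simp only [RingHom.comp_apply, AlgHom.toRingHom_eq_coe, RingHom.coe_coe, rename_X, dirShift_X,
        Polynomial.coe_mapRingHom, Polynomial.map_add, Polynomial.map_mul, Polynomial.map_C, rename_C,
        Polynomial.map_X, Function.comp_apply]
  have h := RingHom.congr_fun key Φ
  simpa using h

/-- `D_w^{(j)}(Φ(x_1..x_4)) = D_{w'}^{(j)}Φ` read in five variables, `w' = (w_1, …, w_4)`. [folklore] -/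
theorem hasseD_rename_succ (w : Fin (4 + 1) → k) (j : ℕ) (Φ : MvPolynomial (Fin 4) k) :
    hasseD w j (rename Fin.succ Φ) = rename Fin.succ (hasseD (w ∘ Fin.succ) j Φ) := by
  rw [hasseD_def, dirShift_rename_succ, Polynomial.coeff_map, ← hasseD_def]
  rfl

/-- `S_p(z^p + Φ) = {w : (w_1..w_4) ∈ S_p(Φ)}`. [folklore] -/
theorem mem_hasseNull_hyp_iff (p : ℕ) [Fact p.Prime] [CharP k p] (Φ : MvPolynomial (Fin 4) k)
    (w : Fin (4 + 1) → k) : w ∈ hasseNull p (hyp p Φ) ↔ (w ∘ Fin.succ) ∈ hasseNull p Φ := by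
  rw [mem_hasseNull, mem_hasseNull]
  refine forall_congr' fun j => forall_congr' fun hj1 => forall_congr' fun hjp => ?_
  rw [hyp, hasseD_add_right, hasseD_X_zero_pow_eq_zero p w hj1 hjp, zero_add, hasseD_rename_succ,
    map_eq_zero_iff _ (rename_injective _ (Fin.succ_injective 4))]

/-- `(z^p + Φ)(w) = w_0^p + Φ(w_1..w_4)`. [folklore] -/
theorem eval_hyp (p : ℕ) (Φ : MvPolynomial (Fin 4) k) (w : Fin (4 + 1) → k) :
    eval w (hyp p Φ) = w 0 ^ p + eval (w ∘ Fin.succ) Φ := by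
  rw [hyp, map_add, map_pow, eval_X, eval_rename]

/-- `z^p + Φ` is a form of degree `p` when `Φ` is. [folklore] -/
theorem hyp_isHomogeneous {p : ℕ} {Φ : MvPolynomial (Fin 4) k} (hΦ : Φ.IsHomogeneous p) :
    (hyp p Φ).IsHomogeneous p := by
  rw [hyp]
  have h1 : ((X 0 : MvPolynomial (Fin (4 + 1)) k) ^ p).IsHomogeneous p := by
    simpa using (isHomogeneous_X k (0 : Fin (4 + 1))).pow p
  have h2 : (rename Fin.succ Φ).IsHomogeneous p := hΦ.rename_isHomogeneous (f := Fin.succ)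
  exact h1.add h2

/-- A form of positive degree vanishes at the origin. [folklore] -/
theorem eval_zero_of_isHomogeneous {p : ℕ} (hp : 0 < p) {Φ : MvPolynomial (Fin 4) k}
    (hΦ : Φ.IsHomogeneous p) : eval (0 : Fin 4 → k) Φ = 0 := by
  rw [MvPolynomial.eval_zero, show constantCoeff Φ = coeff 0 Φ from congrFun constantCoeff_eq Φ]
  exact hΦ.coeff_eq_zero (by rw [map_zero]; exact hp.ne)

/-- `z^p + Φ ≠ 0` for a form `Φ` of degree `p ≥ 1` (value `1` at `(1, 0, …, 0)`). [folklore] -/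
theorem hyp_ne_zero {p : ℕ} (hp : 1 ≤ p) {Φ : MvPolynomial (Fin 4) k} (hΦ : Φ.IsHomogeneous p) :
    hyp p Φ ≠ 0 := by
  intro h
  have h1 := congrArg (eval (Fin.cons (1 : k) (0 : Fin 4 → k))) h
  rw [eval_hyp, map_zero, Fin.cons_zero, one_pow] at h1
  have hcomp : (Fin.cons (1 : k) (0 : Fin 4 → k)) ∘ Fin.succ = 0 := by
    funext i; simp
  rw [hcomp, eval_zero_of_isHomogeneous (by omega) hΦ, add_zero] at h1
  exact one_ne_zero h1

/-! ## 3. The `k`-points of the ridge: `𝕎({z^p + Φ}) = {(c, v) : v ∈ A(Φ), c^p + Φ(v) = 0}` -/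

/-- **The translation-invariance space of `z^p + Φ`.**  For a form `Φ` of degree `p` in characteristic `p`:
`w ∈ 𝕎({z^p + Φ})` iff `(w_1, …, w_4) ∈ A(Φ)` and `w_0^p + Φ(w_1, …, w_4) = 0`.
[cite: CossartJannsenSaito2020, Def. 2.18] [cite: BerthomieuHivertMourtada2010, Cor. 2.3] -/
theorem mem_invarianceSpace_hyp_iff (p : ℕ) [Fact p.Prime] [CharP k p] {Φ : MvPolynomial (Fin 4) k}
    (hΦ : Φ.IsHomogeneous p) (w : Fin (4 + 1) → k) :
    w ∈ invarianceSpace k ({hyp p Φ} : Set (MvPolynomial (Fin (4 + 1)) k)) ↔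
      (w ∘ Fin.succ) ∈ additiveSubspace Φ ∧ w 0 ^ p + eval (w ∘ Fin.succ) Φ = 0 := by
  rw [mem_invarianceSpace_singleton_iff (hyp_isHomogeneous hΦ) (Fact.out : p.Prime).one_le,
    mem_hasseNull_hyp_iff, ← additiveSubspace_eq_hasseNull p Φ, eval_hyp]

/-! ## 4. Dimension: `dim 𝕎({z^p + Φ}) = dim A(Φ)` over a perfect field -/

/-- The projection `w ↦ (w_1, …, w_4)` maps `𝕎({z^p + Φ})` into `A(Φ)`. [folklore] -/
theorem funLeft_mem_additiveSubspace (p : ℕ) [Fact p.Prime] [CharP k p] {Φ : MvPolynomial (Fin 4) k}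
    (hΦ : Φ.IsHomogeneous p) {w : Fin (4 + 1) → k}
    (hw : w ∈ invarianceSpace k ({hyp p Φ} : Set (MvPolynomial (Fin (4 + 1)) k))) :
    LinearMap.funLeft k k Fin.succ w ∈ additiveSubspace Φ :=
  ((mem_invarianceSpace_hyp_iff p hΦ w).mp hw).1

/-- The projection is injective on `𝕎({z^p + Φ})`: `(w_1..w_4) = 0 ⇒ w_0^p = −Φ(0) = 0 ⇒ w = 0`. [folklore] -/
theorem eq_zero_of_funLeft_eq_zero (p : ℕ) [Fact p.Prime] [CharP k p] {Φ : MvPolynomial (Fin 4) k}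
    (hΦ : Φ.IsHomogeneous p) {w : Fin (4 + 1) → k}
    (hw : w ∈ invarianceSpace k ({hyp p Φ} : Set (MvPolynomial (Fin (4 + 1)) k)))
    (h0 : w ∘ Fin.succ = 0) : w = 0 := by
  obtain ⟨-, hc⟩ := (mem_invarianceSpace_hyp_iff p hΦ w).mp hw
  rw [h0, eval_zero_of_isHomogeneous (Fact.out : p.Prime).pos hΦ, add_zero] at hc
  have hw0 : w 0 = 0 := pow_eq_zero_iff (Fact.out : p.Prime).ne_zero |>.mp hc
  funext i
  refine Fin.cases ?_ (fun j => ?_) i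
  · exact hw0
  · exact congrFun h0 j

/-- **`dim_k 𝕎({z^p + Φ}) ≤ dim_k A(Φ)`** over any field of characteristic `p` (the projection is injective).
[cite: CossartJannsenSaito2020, Def. 2.18 and Lemma 2.20 (2)] -/
theorem finrank_invarianceSpace_hyp_le (p : ℕ) [Fact p.Prime] [CharP k p] {Φ : MvPolynomial (Fin 4) k}
    (hΦ : Φ.IsHomogeneous p) :
    Module.finrank k (invarianceSpace k ({hyp p Φ} : Set (MvPolynomial (Fin (4 + 1)) k))) ≤
      Module.finrank k (additiveSubspace Φ) := by
  let π : invarianceSpace k ({hyp p Φ} : Set (MvPolynomial (Fin (4 + 1)) k)) →ₗ[k] additiveSubspace Φ :=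
    (LinearMap.funLeft k k Fin.succ).restrict fun w hw => funLeft_mem_additiveSubspace p hΦ hw
  refine LinearMap.finrank_le_finrank_of_injective (f := π) fun w w' h => ?_
  have hsub : (w - w' : invarianceSpace k ({hyp p Φ} : Set (MvPolynomial (Fin (4 + 1)) k))) = 0 := by
    have hπ : π (w - w') = 0 := by rw [map_sub, h, sub_self]
    have h0 : ((w - w' : invarianceSpace k _) : Fin (4 + 1) → k) ∘ Fin.succ = 0 := by
      have := congrArg Subtype.val hπ
      exact this
    exact Subtype.ext (eq_zero_of_funLeft_eq_zero p hΦ (w - w').2 h0)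
  exact sub_eq_zero.mp hsub

/-- **`dim_k 𝕎({z^p + Φ}) = dim_k A(Φ)` over a PERFECT field of characteristic `p`**: the projection
`(w_0, w') ↦ w'` is a `k`-linear bijection onto `A(Φ)`, the preimage of `v ∈ A(Φ)` being
`((−Φ(v))^{1/p}, v)`. [cite: CossartJannsenSaito2020, Def. 2.18 (e(𝒪) over a perfect residue field)]
[cite: BerthomieuHivertMourtada2010, Cor. 2.3] -/
theorem finrank_invarianceSpace_hyp (p : ℕ) [Fact p.Prime] [CharP k p] [PerfectRing k p]
    {Φ : MvPolynomial (Fin 4) k} (hΦ : Φ.IsHomogeneous p) :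
    Module.finrank k (invarianceSpace k ({hyp p Φ} : Set (MvPolynomial (Fin (4 + 1)) k))) =
      Module.finrank k (additiveSubspace Φ) := by
  let π : invarianceSpace k ({hyp p Φ} : Set (MvPolynomial (Fin (4 + 1)) k)) →ₗ[k] additiveSubspace Φ :=
    (LinearMap.funLeft k k Fin.succ).restrict fun w hw => funLeft_mem_additiveSubspace p hΦ hw
  have hinj : Function.Injective π := by
    intro w w' h
    have hsub : (w - w' : invarianceSpace k ({hyp p Φ} : Set (MvPolynomial (Fin (4 + 1)) k))) = 0 := by
      have hπ : π (w - w') = 0 := by rw [map_sub, h, sub_self]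
      have h0 : ((w - w' : invarianceSpace k _) : Fin (4 + 1) → k) ∘ Fin.succ = 0 := by
        have := congrArg Subtype.val hπ
        exact this
      exact Subtype.ext (eq_zero_of_funLeft_eq_zero p hΦ (w - w').2 h0)
    exact sub_eq_zero.mp hsub
  have hsurj : Function.Surjective π := by
    rintro ⟨v, hv⟩
    set c : k := (frobeniusEquiv k p).symm (-(eval v Φ)) with hc
    have hcp : c ^ p + eval v Φ = 0 := by
      rw [hc, frobeniusEquiv_symm_pow_p, neg_add_cancel]
    have hw : (Fin.cons c v : Fin (4 + 1) → k) ∈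
        invarianceSpace k ({hyp p Φ} : Set (MvPolynomial (Fin (4 + 1)) k)) := by
      rw [mem_invarianceSpace_hyp_iff p hΦ]
      have hcomp : (Fin.cons c v : Fin (4 + 1) → k) ∘ Fin.succ = v := by
        funext i; simp
      rw [hcomp, Fin.cons_zero]
      exact ⟨hv, hcp⟩
    refine ⟨⟨Fin.cons c v, hw⟩, ?_⟩
    apply Subtype.ext
    show (Fin.cons c v : Fin (4 + 1) → k) ∘ Fin.succ = v
    funext i; simp
  exact LinearEquiv.finrank_eq (LinearEquiv.ofBijective π ⟨hinj, hsurj⟩)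

/-! ## 5. `e((z^p + Φ)) = dim A(Φ) = ē(F)` -/

/-- **The directrix of the cone `z^p + Φ` is the ridge**: over a perfect field of characteristic `p`, for a form
`Φ` of degree `p`, the CJS directrix dimension of the principal ideal `(z^p + Φ)` equals the dimension of the
frame's additive subspace: `e((z^p + Φ)) = dim_k A(Φ)`. [cite: CossartJannsenSaito2020, Def. 2.8 and Def. 2.18]
[cite: BerthomieuHivertMourtada2010, Cor. 2.3] -/
theorem directrixDim_span_hyp (p : ℕ) [Fact p.Prime] [CharP k p] [PerfectRing k p]
    {Φ : MvPolynomial (Fin 4) k} (hΦ : Φ.IsHomogeneous p) :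
    directrixDim (Ideal.span {hyp p Φ}) = Module.finrank k (additiveSubspace Φ) := by
  rw [directrixDim_span_singleton (hyp_isHomogeneous hΦ) (hyp_ne_zero (Fact.out : p.Prime).one_le hΦ)]
  have h := hironakaTau_add_finrank_invarianceSpace k ({hyp p Φ} : Set (MvPolynomial (Fin (4 + 1)) k))
  rw [finrank_invarianceSpace_hyp p hΦ] at h
  omega

/-- Over ANY field of characteristic `p`: `e((z^p + Φ)) = 5 − τ = dim_k 𝕎 ≤ dim_k A(Φ)` (the projection of
§4 is injective; equality needs `p`-th roots, `directrixDim_span_hyp`) — the shadow of CJS's `e ≤ ē`.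
[cite: CossartJannsenSaito2020, Lemma 2.20 (2) (e ≤ ē)] -/
theorem directrixDim_span_hyp_le (p : ℕ) [Fact p.Prime] [CharP k p] {Φ : MvPolynomial (Fin 4) k}
    (hΦ : Φ.IsHomogeneous p) :
    directrixDim (Ideal.span {hyp p Φ}) ≤ Module.finrank k (additiveSubspace Φ) := by
  rw [directrixDim_span_singleton (hyp_isHomogeneous hΦ) (hyp_ne_zero (Fact.out : p.Prime).one_le hΦ)]
  have h := hironakaTau_add_finrank_invarianceSpace k ({hyp p Φ} : Set (MvPolynomial (Fin (4 + 1)) k))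
  have h2 := finrank_invarianceSpace_hyp_le p hΦ
  omega

/-- **Frame form: `e((z^p + in F)) = ē(F)`** for a state polynomial of order exactly `p` over a perfect field
(`RidgeBudget.ebar F = dim A(in F)`). [cite: CossartJannsenSaito2020, Def. 2.18 and Def. 2.21] -/
theorem directrixDim_span_hyp_initialForm (p : ℕ) [Fact p.Prime] [CharP k p] [PerfectRing k p]
    {F : MvPolynomial (Fin 4) k} (hord : ordZero F = p) :
    directrixDim (Ideal.span {hyp p (initialForm F)}) = RidgeBudget.ebar F := by
  rw [RidgeBudget.ebar]
  exact directrixDim_span_hyp p (Directrix.initialForm_isHomogeneous hord)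

/-! ## 6. Base change: the same over any perfect extension (for `ē` and for residue-field transports) -/

/-- `map f (z^p + Φ) = z^p + (map f Φ)`. [folklore] -/
theorem map_hyp {K : Type} [Field K] (f : k →+* K) (p : ℕ) (Φ : MvPolynomial (Fin 4) k) :
    MvPolynomial.map f (hyp p Φ) = hyp p (MvPolynomial.map f Φ) := by
  rw [hyp, hyp, map_add, map_pow, map_X, map_rename]

/-- **`e((z^p + Φ) ⊗_k K) = dim_K A(Φ ⊗ K) = dim_k A(Φ)`** for a perfect extension `K/k` (e.g. `K = k̄`, giving
`ē`): the identity of §5 over `K` and the tree's base change `PointBlowup.finrank_additiveSubspace_map`.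
[cite: CossartJannsenSaito2020, Def. 2.21 (ē over the algebraic closure) and Lemma 2.20 (2)] -/
theorem directrixDim_span_map_hyp (p : ℕ) [Fact p.Prime] [CharP k p] {K : Type} [Field K] [CharP K p]
    [PerfectRing K p] [Algebra k K] {Φ : MvPolynomial (Fin 4) k} (hΦ : Φ.IsHomogeneous p) :
    directrixDim (Ideal.span {MvPolynomial.map (algebraMap k K) (hyp p Φ)}) =
      Module.finrank k (additiveSubspace Φ) := by
  rw [map_hyp, directrixDim_span_hyp p (hΦ.map (algebraMap k K)), PointBlowup.finrank_additiveSubspace_map]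

/-- The same along an arbitrary field homomorphism `f : k → K` into a perfect field, in `K`-terms:
`e((map f (z^p + Φ))) = dim_K A(map f Φ)`. [cite: CossartJannsenSaito2020, Def. 2.18] -/
theorem directrixDim_span_map_hyp' (p : ℕ) [Fact p.Prime] {K : Type} [Field K] [CharP K p] [PerfectRing K p]
    (f : k →+* K) {Φ : MvPolynomial (Fin 4) k} (hΦ : Φ.IsHomogeneous p) :
    directrixDim (Ideal.span {MvPolynomial.map f (hyp p Φ)}) =
      Module.finrank K (additiveSubspace (MvPolynomial.map f Φ)) := by
  rw [map_hyp, directrixDim_span_hyp p (hΦ.map f)]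

/-- Frame form over a perfect extension: `e((z^p + in F) ⊗ K) = ē(F)` at `ord₀ F = p`.
[cite: CossartJannsenSaito2020, Def. 2.21] -/
theorem directrixDim_span_map_hyp_initialForm (p : ℕ) [Fact p.Prime] [CharP k p] {K : Type} [Field K]
    [CharP K p] [PerfectRing K p] [Algebra k K] {F : MvPolynomial (Fin 4) k} (hord : ordZero F = p) :
    directrixDim (Ideal.span {MvPolynomial.map (algebraMap k K) (hyp p (initialForm F))}) =
      RidgeBudget.ebar F := by
  rw [RidgeBudget.ebar]
  exact directrixDim_span_map_hyp p (Directrix.initialForm_isHomogeneous hord)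

end RidgeDirectrix

end Summit.ResolutionOfSingularities.ResolutionOfSingularities.Theorems.PIDim4

end
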